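import Mathlib.LinearAlgebra.Matrix.Rank
import Literature.Computability.AlgebraicComplexity.RankMethodBarriers
import Summits.MatrixMultiplication.MatrixMultiplication.Theses.ProbeRankScaling

/-!
# MatrixMultiplication / ProbeRankScaling — support `OneLegLaw` (stmt-MatrixMultiplication-7536)

The ONE-LEG LAW for bilinear algorithms of `⟨a, b, c⟩`: if
`⟨a,b,c⟩ = ∑_l w_l ⊗ u_l ⊗ v_l` (tree convention: `w_l ∈ M_{a×c}` the output probe,
`u_l ∈ M_{a×b}`, `v_l ∈ M_{b×c}`), then
`abc ≤ ∑_l rank w_l`, `abc ≤ ∑_l rank u_l`, `abc ≤ ∑_l rank v_l`.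

Proof (split-leg flattening). Fix a leg, say `w ∈ M_{a×c}` with row index `i` and column index
`k`. Flatten the tensor to the matrix with ROW index `(i, z)` — the row index of the chosen leg
together with the whole leg `z = (j', k') ∈ b × c` not involving `i` — and COLUMN index
`(k, y)` — the column index of the chosen leg together with the whole leg `y = (i', j) ∈ a × b`
not involving `k`. Under this flattening

* `⟨a,b,c⟩` becomes a permutation matrix of size `abc` (row `(i, (j, k))` has its single `1` in
  column `(k, (i, j))`), hence has rank `abc` (we only use `M Mᵀ = 1 ⇒ abc = rank 1 ≤ rank M`);
* a triad `w ⊗ u ⊗ v` becomes the matrix `((i,z),(k,y)) ↦ w_{ik} v_z u_y = (D_v ⊗ 1) · w · (1 ⊗ u)`,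
  a product `A · W · B` through the `a × c` matrix `W = w`, hence of rank `≤ rank w`.

Rank subadditivity (`matrix_rank_sum_le`) gives `abc ≤ ∑_l rank w_l`. The other two legs are the
same computation with the roles of the legs permuted (`u`: rows `(i', z)`, columns `(j, x)`;
`v`: rows `(j', x)`, columns `(k', y)`), so all three are instances of one abstract lemma
`card_le_sum_rank_of_splitLeg`.

References: standard (flattenings / substitution method), e.g. J. M. Landsberg, *Geometry and
Complexity Theory* (2017), §2.1; M. Bläser, *Fast Matrix Multiplication* (2013), §4–6;
Bürgisser–Clausen–Shokrollahi (1997), Ch. 14.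
-/

noncomputable section

open scoped BigOperators

namespace Summit.MatrixMultiplication.MatrixMultiplication.Theorems

open Literature.Computability.AlgebraicComplexity

/-- The split-leg flattening of a triad factors through its chosen probe: the matrix
`((i,p),(k,q)) ↦ m (i,k) · g p · h q` equals `A · M · B` with `M = (m (i,k))_{ik}`, so its rank is
at most `rank M`. [folklore] -/
theorem rank_splitLeg_triad_le {α β P Q : Type*} [Fintype α] [Fintype β] [Fintype P]
    [Fintype Q] (m : α × β → ℂ) (g : P → ℂ) (h : Q → ℂ) :
    (Matrix.of fun (i : α × P) (j : β × Q) => m (i.1, j.1) * g i.2 * h j.2).rank ≤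
      (Matrix.of (Function.curry m)).rank := by
  classical
  have hfac : (Matrix.of fun (i : α × P) (j : β × Q) => m (i.1, j.1) * g i.2 * h j.2) =
      (Matrix.of fun (i : α × P) (x : α) => if i.1 = x then g i.2 else 0) *
        Matrix.of (Function.curry m) *
        (Matrix.of fun (y : β) (j : β × Q) => if j.1 = y then h j.2 else 0) := by
    ext i j
    simp only [Matrix.mul_apply, Matrix.of_apply, ite_mul, zero_mul, Finset.sum_ite_eq,
      Finset.mem_univ, if_true, mul_ite, mul_zero, Function.curry_apply]
    ring
  rw [hfac]
  exact (Matrix.rank_mul_le_left _ _).trans (Matrix.rank_mul_le_right _ _)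

/-- Abstract one-leg law. Suppose the split-leg flattening of `∑_l m_l ⊗ g_l ⊗ h_l` — rows
`(i, p) ∈ α × P`, columns `(k, q) ∈ β × Q`, entry `∑_l m_l (i,k) g_l p h_l q` — is a partial
permutation matrix: row `ρ` has a single `1`, in column `f ρ`, with `f` injective. Then
`|α × P| ≤ ∑_l rank m_l`. Proof: `M Mᵀ = 1`, so `|α × P| = rank 1 ≤ rank M ≤ ∑_l rank(flattened
triad) ≤ ∑_l rank m_l`. [folklore] -/
theorem card_le_sum_rank_of_splitLeg {α β P Q : Type*} [Fintype α] [Fintype β] [Fintype P]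
    [Fintype Q] [DecidableEq β] [DecidableEq Q] {r : ℕ}
    (m : Fin r → α × β → ℂ) (g : Fin r → P → ℂ) (h : Fin r → Q → ℂ)
    (f : α × P → β × Q) (hf : Function.Injective f)
    (hsum : ∀ (i : α × P) (j : β × Q),
      (∑ l, m l (i.1, j.1) * g l i.2 * h l j.2) = if j = f i then 1 else 0) :
    Fintype.card (α × P) ≤ ∑ l, (Matrix.of (Function.curry (m l))).rank := by
  classical
  set M : Matrix (α × P) (β × Q) ℂ := Matrix.of fun i j => if j = f i then (1 : ℂ) else 0
    with hM
  have hMM : M * M.transpose = 1 := by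
    ext i i'
    simp only [Matrix.mul_apply, Matrix.transpose_apply, hM, Matrix.of_apply, mul_ite, mul_one,
      mul_zero, Finset.sum_ite_eq', Finset.mem_univ, if_true, Matrix.one_apply]
    by_cases hii' : i = i'
    · subst hii'
      simp
    · have hne : f i' ≠ f i := fun e => hii' (hf e).symm
      simp [hii', hne]
  have hcard : Fintype.card (α × P) ≤ M.rank := by
    calc Fintype.card (α × P) = (M * M.transpose).rank := by rw [hMM, Matrix.rank_one]
      _ ≤ M.rank := Matrix.rank_mul_le_left _ _
  have hMsum : M = ∑ l, Matrix.of fun (i : α × P) (j : β × Q) =>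
      m l (i.1, j.1) * g l i.2 * h l j.2 := by
    ext i j
    rw [Matrix.sum_apply]
    simp only [hM, Matrix.of_apply]
    exact (hsum i j).symm
  calc Fintype.card (α × P) ≤ M.rank := hcard
    _ = (∑ l, Matrix.of fun (i : α × P) (j : β × Q) =>
          m l (i.1, j.1) * g l i.2 * h l j.2).rank := by rw [hMsum]
    _ ≤ ∑ l, (Matrix.of fun (i : α × P) (j : β × Q) =>
          m l (i.1, j.1) * g l i.2 * h l j.2).rank := matrix_rank_sum_le _ _
    _ ≤ ∑ l, (Matrix.of (Function.curry (m l))).rank :=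
        Finset.sum_le_sum fun l _ => rank_splitLeg_triad_le _ _ _

/-- **One-leg law** (support item `OneLegLaw` of route ProbeRankScaling,
stmt-MatrixMultiplication-7536): for every decomposition `⟨a,b,c⟩ = ∑_l w_l ⊗ u_l ⊗ v_l` over `ℂ`
(output probes `w_l ∈ M_{a×c}`, `u_l ∈ M_{a×b}`, `v_l ∈ M_{b×c}`),
`abc ≤ ∑_l rank w_l`, `abc ≤ ∑_l rank u_l` and `abc ≤ ∑_l rank v_l`. [folklore] -/
theorem oneLegLaw_proof :
    Summit.MatrixMultiplication.MatrixMultiplication.Theses.ProbeRankScaling.OneLegLaw := by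
  unfold Summit.MatrixMultiplication.MatrixMultiplication.Theses.ProbeRankScaling.OneLegLaw
  intro a b c r w u v hT
  -- entrywise form of the decomposition
  have key : ∀ (x : Fin a × Fin c) (y : Fin a × Fin b) (z : Fin b × Fin c),
      (∑ l, w l x * u l y * v l z) = if x.1 = y.1 ∧ y.2 = z.1 ∧ x.2 = z.2 then 1 else 0 := by
    intro x y z
    have hxyz := congr_fun (congr_fun (congr_fun hT x) y) z
    simp only [Finset.sum_apply, triad_apply, matMulTensor] at hxyz
    exact hxyz.symm
  refine ⟨?_, ?_, ?_⟩
  · -- the `w`-leg: rows `(i, (j', k'))`, columns `(k, (i', j))`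
    have hw := card_le_sum_rank_of_splitLeg (α := Fin a) (β := Fin c) (P := Fin b × Fin c)
      (Q := Fin a × Fin b) w v u (fun p => (p.2.2, (p.1, p.2.1))) ?_ ?_
    · refine le_of_eq_of_le ?_ hw
      simp only [Fintype.card_prod, Fintype.card_fin]
      ring
    · rintro ⟨i, j, k⟩ ⟨i', j', k'⟩ e
      simp only [Prod.mk.injEq] at e
      obtain ⟨rfl, rfl, rfl⟩ := e
      rfl
    · rintro ⟨i, j', k'⟩ ⟨k, i', j⟩
      dsimp only
      have hcomm : ∀ l, w l (i, k) * v l (j', k') * u l (i', j) =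
          w l (i, k) * u l (i', j) * v l (j', k') := fun l => by ring
      rw [Finset.sum_congr rfl fun l _ => hcomm l, key]
      dsimp only
      refine if_congr ?_ rfl rfl
      simp only [Prod.mk.injEq]
      constructor
      · rintro ⟨h1, h2, h3⟩; subst_vars; exact ⟨rfl, rfl, rfl⟩
      · rintro ⟨h1, h2, h3⟩; subst_vars; exact ⟨rfl, rfl, rfl⟩
  · -- the `u`-leg: rows `(i', (j', k'))`, columns `(j, (i, k))`
    have hu := card_le_sum_rank_of_splitLeg (α := Fin a) (β := Fin b) (P := Fin b × Fin c)
      (Q := Fin a × Fin c) u v w (fun p => (p.2.1, (p.1, p.2.2))) ?_ ?_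
    · refine le_of_eq_of_le ?_ hu
      simp only [Fintype.card_prod, Fintype.card_fin]
      ring
    · rintro ⟨i, j, k⟩ ⟨i', j', k'⟩ e
      simp only [Prod.mk.injEq] at e
      obtain ⟨rfl, rfl, rfl⟩ := e
      rfl
    · rintro ⟨i', j', k'⟩ ⟨j, i, k⟩
      dsimp only
      have hcomm : ∀ l, u l (i', j) * v l (j', k') * w l (i, k) =
          w l (i, k) * u l (i', j) * v l (j', k') := fun l => by ring
      rw [Finset.sum_congr rfl fun l _ => hcomm l, key]
      dsimp only
      refine if_congr ?_ rfl rfl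
      simp only [Prod.mk.injEq]
      constructor
      · rintro ⟨h1, h2, h3⟩; subst_vars; exact ⟨rfl, rfl, rfl⟩
      · rintro ⟨h1, h2, h3⟩; subst_vars; exact ⟨rfl, rfl, rfl⟩
  · -- the `v`-leg: rows `(j', (i, k))`, columns `(k', (i', j))`
    have hv := card_le_sum_rank_of_splitLeg (α := Fin b) (β := Fin c) (P := Fin a × Fin c)
      (Q := Fin a × Fin b) v w u (fun p => (p.2.2, (p.2.1, p.1))) ?_ ?_
    · refine le_of_eq_of_le ?_ hv
      simp only [Fintype.card_prod, Fintype.card_fin]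
      ring
    · rintro ⟨j, i, k⟩ ⟨j', i', k'⟩ e
      simp only [Prod.mk.injEq] at e
      obtain ⟨rfl, rfl, rfl⟩ := e
      rfl
    · rintro ⟨j', i, k⟩ ⟨k', i', j⟩
      dsimp only
      have hcomm : ∀ l, v l (j', k') * w l (i, k) * u l (i', j) =
          w l (i, k) * u l (i', j) * v l (j', k') := fun l => by ring
      rw [Finset.sum_congr rfl fun l _ => hcomm l, key]
      dsimp only
      refine if_congr ?_ rfl rfl
      simp only [Prod.mk.injEq]
      constructor
      · rintro ⟨h1, h2, h3⟩; subst_vars; exact ⟨rfl, rfl, rfl⟩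
      · rintro ⟨h1, h2, h3⟩; subst_vars; exact ⟨rfl, rfl, rfl⟩

end Summit.MatrixMultiplication.MatrixMultiplication.Theorems
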